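import Mathlib.Data.ZMod.Basic
import Mathlib.Tactic.NormNum
import Mathlib.Tactic.Linarith
import Mathlib.Tactic.FinCases
import Mathlib.Tactic.FieldSimp
import Mathlib.Tactic.Ring
import Mathlib.Tactic.Positivity
import Mathlib.Data.Fintype.Prod
import Mathlib.Algebra.Field.ZMod
import Literature.NumberTheory.EllipticCurves.BhargavaSkinnerZhang2014.LocalDensitiesAtFive
import Literature.NumberTheory.EllipticCurves.BhargavaSkinnerZhang2014.TateDiscDensitiesTwoThree
import Literature.NumberTheory.EllipticCurves.BhargavaSkinnerZhang2014.NodalClasses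
import HarnessLib

/-!
# Trace-zero (supersingular) residue classes of `y² = x³ + Ax + B` at `p = 3, 5, 7, 11, 13`, and the exact naive-height densities they give

Sources: J. H. Silverman, *The Arithmetic of Elliptic Curves*, 2nd ed., GTM 106 (2009) [SilvermanAEC2009]:
Thm. V.4.1(a) (for `p ≥ 3` and `E : y² = f(x)` over `𝔽_q`, `E` is supersingular iff the coefficient of
`x^{p-1}` in `f(x)^{(p-1)/2}` vanishes — the Hasse polynomial), Examples V.4.3–V.4.5 (supersingular `j` at
`11` are `0, 1728`; `j = 0` supersingular iff `p ≡ 2 (mod 3)`; `j = 1728` iff `p ≡ 3 (mod 4)`), Exercise 5.10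
(a)–(c) (`E/𝔽_q` supersingular iff `tr φ ≡ 0 (mod p)`; for a prime `q = p ≥ 5`, iff `#E(𝔽_p) = p + 1`, i.e.
`a_p = 0`; at `p = 3` one computes `#E(𝔽₃)` directly); M. Deuring, *Die Typen der Multiplikatorenringe
elliptischer Funktionenkörper*, Abh. Math. Sem. Hamburg 14 (1941) [Deuring1941] (the Hasse-invariant /
supersingular `j` count); and, for the in-family normalisation `1 - p⁻¹⁰` of naive-height densities on
`(A, B) ∈ ℤ_p²`, M. Bhargava, C. Skinner, W. Zhang, arXiv:1407.1826v2 (2014) [BhargavaSkinnerZhang2014] §3.1,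
Lemma 17 (as in the two imported files).  Locators of [SilvermanAEC2009] read on the held text
(`book:silverman2009-arithmetic-elliptic-curves-2nd-ed`, §V.4 and Exercises to Ch. V) by the `pub-bsdpct` engine seat, 2026-08-18.

Reproduction (all statements are finite computations over `(ℤ/p)²` checked by the kernel with `decide`, or
closed-form rational arithmetic checked with `norm_num` / `field_simp`):
* (§1, `p = 3`) the TRACE TABLE of the short family over `𝔽₃`: on the good disc `{3 ∤ A}` (where the short
  model is `3`-minimal with good, hence supersingular, reduction — imported file `TateDiscDensitiesTwoThree`,
  `disc3_ne_zero_iff`, `affinePoints3_mod_three`), `a₃ = 3 - #affine points` depends only on `(A, B) mod 3`: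
  `(1,0), (1,1), (1,2), (2,0) ↦ 0`, `(2,1) ↦ -3`, `(2,2) ↦ +3`; hence the in-family densities
  `μ₃(ss ∧ a₃ = 0) = 6561/14762` and `μ₃(ss ∧ a₃ = ±3) = 6561/29524` partitioning `μ₃(good ss) = 19683/29524`.
* (§2, `p = 5, 7, 11, 13`) the TRACE-ZERO classes `{disc ≠ 0, #affine points = p}` (`a_p = 0`; for `p ≥ 5`
  this is "supersingular", Exercise 5.10(b)): they are exactly the zero sets of the Hasse polynomials
  `2A` (`p = 5`, = the imported `GoodSS5`), `3B` (`7`), `20AB` (`11`), `20A³ + 15B² ≡ 7A³ + 2B²` (`13`) off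
  `(0,0)`, with `N_ss(p) = 4, 6, 20, 12` pairs — i.e. `p - 1` pairs per supersingular `j`, `j = 0` at `5`,
  `j = 1728` at `7`, both at `11`, `j = 5` at `13` (Deuring / Silverman V.4.1(c): `[p/12] + ε_p`).
* (§3) the exact densities these give in the family ordered by naive height: additive `μ_add(p) =
  (p⁸ - 1)/(p¹⁰ - 1)` (`p ≥ 5`; NOT valid at `2, 3`, where Tate's algorithm gives the imported constants),
  trace-zero `μ_ss(p) = N_ss(p)/(p²(1 - p⁻¹⁰))`, and `μ_add(p) + μ_ss(p) = (p⁹ - 1)/(p¹⁰ - 1) < 1/p` whenever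
  `N_ss(p) = p - 1` (`p = 5, 7, 13`); at `11` it is `(21·11⁸ - 1)/(11¹⁰ - 1)`; the union over `{5, 7, 11, 13}`
  has density in `(0.4768866, 0.4768868)`; at `3`, `1 - μ₃(ordinary) - μ₃(multiplicative) = 29523/29524`.
* (§4, added 2026-08-18) the MULTIPLICATIVE (nodal) classes at `p ≥ 5`: `μ_mult(p) = ((p - 1)/p²)/(1 - p⁻¹⁰) =
  (p - 1)p⁸/(p¹⁰ - 1)`, the `p - 1` classes `4A³ + 27B² ≡ 0, A ≢ 0` counted for every prime `p ≥ 5` by the imported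
  `card_nodal_zmod`; at `5` it is `390625/2441406 = μ_ss5` and the sum of the five corrected Lemma-18 cells of
  `LocalDensitiesAtFive`; the four types partition the family (`μ_ord + μ_ss + μ_mult + μ_add = 1`, with
  `μ_ord(p) = ((p² - p - N_ss(p))/p²)/(1 - p⁻¹⁰)`, `= μ_go5` at `5`); and the rank-1 analogue of the §3 unions,
  `μ_add + μ_ss + μ_mult = 1 - μ_ord` — `439453/1220703` at `5`, `(2p⁹ - p⁸ - 1)/(p¹⁰ - 1)` whenever `N_ss(p) = p - 1`,
  union over `{5, 7, 11, 13}` in `(0.7019978, 0.7019979)`.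

Use: these are the kernel-checked inputs of the HEIGHT CENSUS of the residual classes of the BSD formula in
analytic rank ≤ 1 (bundle `pub-bsdpct`, `RESIDUAL-CASES.md` §(b-H) / `numerics/PROOFS.md` §12 /
`numerics/residual_density.py`, 25 numerical checks; 30 since its gen-26 revision): rows X4 (additive `p`), X6–X8 (supersingular `p`; at `3` split
by `a₃ = 0` versus `a₃ = ±3`), and the "open by class theorem in rank 0" unions; §4 serves the rows X11r1 (multiplicative
`p ≥ 5`, analytic rank 1) and the "open by class in rank 1" unions of that census's 2026-08-18 revision, in which no
PUBLISHED theorem covers the multiplicative primes `p ≥ 5` in analytic rank 1 as a class (its former row C4 — F. Castella,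
Camb. J. Math. 6 (2018), Thm. A — having been withdrawn by the author's erratum; nothing below refers to that theorem,
only residue-class bookkeeping of the short family is stated).  The semistability co-factors of
that census (`S = P(E semistable) = .0017828984…`, an Euler product) are interval-certified numerics and are NOT
entered here; only `S`-free quantities are stated, plus the algebraic partition identity they satisfy.

Relation to the tree: extends `LocalDensitiesAtFive` (`disc`, `fam`, `affinePoints`, `GoodSS5`, `card_goodSS5 = 4`,
`μ_add5`, `μ_ss5`; for §4 `μ_go5`, `Mult5`, `card_mult5 = 4` and the five cells `μ_ns_ok5 … μ_sp_badv5`), `NodalClasses`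
(`card_nodal_zmod`: `p - 1` nodal classes for every prime `p ≥ 5`) and `TateDiscDensitiesTwoThree` (`affinePoints3`, `μ3_goodSS`, `μ3_goodOrd`, `μ3_mult`,
`μ3_additive`) of this directory, and proves its general-`p` definitions agree with those at `p = 3, 5`
(`affinePointsMod_three`, `affinePointsMod_five`, `traceZero5_iff_goodSS5`, `μ_add_five`, `μ_ssN_five`).  The tree's
Hasse-invariant theory for general Weierstrass curves (`WeierstrassCurve.hasseCoeff`, `hasseCoeffAt`,
`cast_card_add_one_sub_natCard_point` in `FormalGroupHasseInvariantProofs` / `IwasawaSelmerSupersingularLocalProofs`)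
is the conceptual home of "trace zero ⟺ Hasse polynomial zero"; here the equivalence is verified class by class
for the short family at the four primes, which is what the census consumes.  No tree file states `N_ss(7), N_ss(11),
N_ss(13)` or the `a₃`-split at `3`.

What is NOT here: supersingularity as a property of `E/𝔽_p` (endomorphism ring, `E[p] = 0`) and its
equivalence with `a_p = 0` — cited (Silverman V.3.1, Ex. 5.10), not formalised; the `S`-dependent census rows;
anything about elliptic curves over `ℚ` beyond the residue-class bookkeeping.
-/

namespace Literature.NumberTheory.EllipticCurves.BhargavaSkinnerZhang2014.Densities

/-! ## §1. The trace table at `p = 3` and the `a₃`-split of the supersingular two thirds -/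

/-- `a₃` of the short model `y² = x³ + Ax + B` read on `(A, B) mod 3`: `a₃ = 3 - #(affine points over 𝔽₃)`
(`#E(𝔽₃) = affine + 1 = 3 + 1 - a₃`).  Meaningful on the good disc `3 ∤ A`, where the model is `3`-minimal
with good reduction (`disc3_ne_zero_iff`). [cite: SilvermanAEC2009, Exercise 5.10(c)] [folklore] -/
def a3 (A B : ZMod 3) : ℤ := 3 - (affinePoints3 A B : ℤ)

/-- THE TRACE TABLE AT 3: on the six good classes `A ≢ 0 (mod 3)`, `a₃ = 0` on `(1,0), (1,1), (1,2), (2,0)`,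
`a₃ = -3` on `(2,1)` (`#E(𝔽₃) = 7`), `a₃ = +3` on `(2,2)` (`#E(𝔽₃) = 1`).  (PROOFS.md §12.2.)
[cite: SilvermanAEC2009, Exercise 5.10(c)] [folklore] -/
theorem a3_table : ∀ AB : ZMod 3 × ZMod 3, AB.1 ≠ 0 →
    a3 AB.1 AB.2 = (if AB = (2, 1) then -3 else if AB = (2, 2) then 3 else 0) := by
  decide

/-- Affine point counts over `𝔽₃` on the good classes take only the values `3, 6, 0` (`a₃ ∈ {0, -3, +3}`).
[cite: SilvermanAEC2009, Exercise 5.10(c)] [folklore] -/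
theorem affinePoints3_values : ∀ AB : ZMod 3 × ZMod 3, AB.1 ≠ 0 →
    affinePoints3 AB.1 AB.2 = 3 ∨ affinePoints3 AB.1 AB.2 = 6 ∨ affinePoints3 AB.1 AB.2 = 0 := by
  decide

/-- Four of the six good classes mod 3 have `a₃ = 0`. [cite: SilvermanAEC2009, Exercise 5.10(c)] [folklore] -/
theorem card_good3_a3_zero :
    (Finset.univ.filter (fun AB : ZMod 3 × ZMod 3 => AB.1 ≠ 0 ∧ affinePoints3 AB.1 AB.2 = 3)).card = 4 := by
  decide

/-- Exactly one good class mod 3 has `a₃ = -3` (namely `(2,1)`). [cite: SilvermanAEC2009, Exercise 5.10(c)] [folklore] -/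
theorem card_good3_a3_neg :
    (Finset.univ.filter (fun AB : ZMod 3 × ZMod 3 => AB.1 ≠ 0 ∧ affinePoints3 AB.1 AB.2 = 6)).card = 1 := by
  decide

/-- Exactly one good class mod 3 has `a₃ = +3` (namely `(2,2)`). [cite: SilvermanAEC2009, Exercise 5.10(c)] [folklore] -/
theorem card_good3_a3_pos :
    (Finset.univ.filter (fun AB : ZMod 3 × ZMod 3 => AB.1 ≠ 0 ∧ affinePoints3 AB.1 AB.2 = 0)).card = 1 := by
  decide

/-- All nine classes: the good ones are exactly `A ≢ 0`, six of them. [folklore] -/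
theorem card_good3 : (Finset.univ.filter (fun AB : ZMod 3 × ZMod 3 => AB.1 ≠ 0)).card = 6 := by decide

/-- In-family naive-height density of `{good supersingular at 3 ∧ a₃ = 0}` = `(4/9)/(1 - 3⁻¹⁰) = 6561/14762`
(four classes mod 3 of Haar mass `1/9` each; class X7∖X8 ∪ X6 of the census at `p = 3`). [folklore] -/
def μ3_ss_a3zero : ℚ := 6561 / 14762

/-- In-family density of `{good supersingular at 3 ∧ a₃ = ±3}` = `(2/9)/(1 - 3⁻¹⁰) = 6561/29524` (census class X8);
each sign `6561/59048`. [folklore] -/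
def μ3_ss_a3pm : ℚ := 6561 / 29524

/-- `μ₃(ss ∧ a₃ = 0) = (4/9)/fam 3`. [folklore] -/
theorem μ3_ss_a3zero_eq : μ3_ss_a3zero = (4 / 9) / fam 3 := by norm_num [μ3_ss_a3zero, fam]

/-- `μ₃(ss ∧ a₃ = ±3) = (2/9)/fam 3`, and each sign `(1/9)/fam 3 = 6561/59048`. [folklore] -/
theorem μ3_ss_a3pm_eq : μ3_ss_a3pm = (2 / 9) / fam 3 ∧ μ3_ss_a3pm / 2 = (1 / 9) / fam 3 ∧
    (6561 / 59048 : ℚ) = (1 / 9) / fam 3 := by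
  refine ⟨?_, ?_, ?_⟩ <;> norm_num [μ3_ss_a3pm, fam]

/-- The `a₃`-split partitions the supersingular two thirds: `6561/14762 + 6561/29524 = 19683/29524 = μ3_goodSS`.
[folklore] -/
theorem μ3_ss_split : μ3_ss_a3zero + μ3_ss_a3pm = μ3_goodSS := by
  norm_num [μ3_ss_a3zero, μ3_ss_a3pm, μ3_goodSS]

/-- Decimal containers used in the census table: `.4444 < μ₃(ss, a₃ = 0) < .4445` (`= .4444520`), `.2222 < μ₃(ss, a₃ = ±3) < .2223` (`= .2222260`).
[folklore] -/
theorem μ3_ss_split_bounds : (0.4444 : ℚ) < μ3_ss_a3zero ∧ μ3_ss_a3zero < 0.4445 ∧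
    (0.2222 : ℚ) < μ3_ss_a3pm ∧ μ3_ss_a3pm < 0.2223 := by
  refine ⟨?_, ?_, ?_, ?_⟩ <;> norm_num [μ3_ss_a3zero, μ3_ss_a3pm]

/-! ## §2. Trace-zero classes at `p = 5, 7, 11, 13` = zero sets of the Hasse polynomials; the counts `N_ss(p)` -/

/-- Number of affine points of `y² = x³ + Ax + B` over `ℤ/p` (for `p` prime, `#E(𝔽_p) - 1 = p - a_p`).
[cite: SilvermanAEC2009, Exercise 5.10(b)] [folklore] -/
def affinePointsMod (p : ℕ) [NeZero p] (A B : ZMod p) : ℕ :=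
  (Finset.univ.filter (fun xy : ZMod p × ZMod p => xy.2 ^ 2 = xy.1 ^ 3 + A * xy.1 + B)).card

/-- Agrees with the imported `affinePoints3` at `p = 3`. [folklore] -/
theorem affinePointsMod_three (A B : ZMod 3) : affinePointsMod 3 A B = affinePoints3 A B := rfl

/-- Agrees with the imported `affinePoints` at `p = 5`. [folklore] -/
theorem affinePointsMod_five (A B : ZMod 5) : affinePointsMod 5 A B = affinePoints A B := rfl

/-- TRACE-ZERO class: `disc = 4A³ + 27B² ≠ 0` and `#affine points = p`, i.e. `a_p = 0`; for a prime `p ≥ 5` this is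
"`E_{A,B}/𝔽_p` is supersingular" (Hasse bound + Exercise 5.10(a),(b)), and for the short model over `ℤ` with
`(A, B)` in such a class mod `p` it is "good supersingular reduction at `p`" (the model is `p`-minimal as `p ∤ Δ`).
[cite: SilvermanAEC2009, Exercise 5.10(b)] [folklore] -/
def TraceZero (p : ℕ) [NeZero p] (AB : ZMod p × ZMod p) : Prop :=
  disc AB.1 AB.2 ≠ 0 ∧ affinePointsMod p AB.1 AB.2 = p

/-- `TraceZero p` is decidable (by unfolding). [folklore] -/
instance (p : ℕ) [NeZero p] : DecidablePred (TraceZero p) := fun _ => by unfold TraceZero; infer_instance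

/-- At `p = 5` the trace-zero classes are the imported `GoodSS5 = {A = 0, B ≠ 0}` (Hasse polynomial `2A`; `j = 0`).
[cite: SilvermanAEC2009, Thm. V.4.1(a) and Example V.4.4] -/
theorem traceZero5_iff_goodSS5 : ∀ AB : ZMod 5 × ZMod 5, TraceZero 5 AB ↔ GoodSS5 AB := by decide

/-- `N_ss(5) = 4` (re-derived; equals the imported `card_goodSS5`). [cite: SilvermanAEC2009, Thm. V.4.1(a) and Example V.4.4] -/
theorem card_traceZero5 : (Finset.univ.filter (TraceZero 5)).card = 4 := by decide

set_option maxRecDepth 100000 in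
/-- At `p = 7` the trace-zero classes are `{B = 0, A ≠ 0}` — the zero set of the Hasse polynomial `3B`
(coefficient of `x⁶` in `(x³ + Ax + B)³`), i.e. `j = 1728`, supersingular since `7 ≡ 3 (mod 4)`.
[cite: SilvermanAEC2009, Thm. V.4.1(a) and Example V.4.5] -/
theorem traceZero7_iff : ∀ AB : ZMod 7 × ZMod 7, TraceZero 7 AB ↔ (AB.1 ≠ 0 ∧ AB.2 = 0) := by decide

set_option maxRecDepth 100000 in
/-- `N_ss(7) = 6` trace-zero classes mod 7 (`= p - 1` pairs over the one supersingular `j = 1728`).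
[cite: SilvermanAEC2009, Thm. V.4.1(a),(c) and Example V.4.5] -/
theorem card_traceZero7 : (Finset.univ.filter (TraceZero 7)).card = 6 := by decide

set_option maxRecDepth 100000 in
/-- Nonsingular classes mod 7: `7² - 7 = 42`. [folklore] -/
theorem card_disc7_ne_zero : (Finset.univ.filter (fun AB : ZMod 7 × ZMod 7 => disc AB.1 AB.2 ≠ 0)).card = 42 := by
  decide

set_option maxRecDepth 200000 in
set_option maxHeartbeats 4000000 in
/-- At `p = 11` the trace-zero classes are `{A = 0} ∪ {B = 0}` minus `(0,0)` — the zero set of the Hasse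
polynomial `20AB ≡ 9AB` (coefficient of `x¹⁰` in `(x³ + Ax + B)⁵`), i.e. `j ∈ {0, 1728}`.
[cite: SilvermanAEC2009, Thm. V.4.1(a) and Example V.4.3] -/
theorem traceZero11_iff : ∀ AB : ZMod 11 × ZMod 11,
    TraceZero 11 AB ↔ (AB ≠ (0, 0) ∧ (AB.1 = 0 ∨ AB.2 = 0)) := by
  decide

set_option maxRecDepth 200000 in
set_option maxHeartbeats 4000000 in
/-- `N_ss(11) = 20` trace-zero classes mod 11 (`10` over `j = 0` and `10` over `j = 1728`).
[cite: SilvermanAEC2009, Thm. V.4.1(a),(c) and Example V.4.3] -/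
theorem card_traceZero11 : (Finset.univ.filter (TraceZero 11)).card = 20 := by decide

set_option maxRecDepth 200000 in
set_option maxHeartbeats 4000000 in
/-- Nonsingular classes mod 11: `11² - 11 = 110`. [folklore] -/
theorem card_disc11_ne_zero :
    (Finset.univ.filter (fun AB : ZMod 11 × ZMod 11 => disc AB.1 AB.2 ≠ 0)).card = 110 := by
  decide

set_option maxRecDepth 400000 in
set_option maxHeartbeats 8000000 in
/-- At `p = 13` the trace-zero classes are the zero set of the Hasse polynomial `20A³ + 15B² ≡ 7A³ + 2B² (mod 13)`
(coefficient of `x¹²` in `(x³ + Ax + B)⁶`) off `(0,0)`: the twelve pairs `(1,±4), (3,±4), (9,±4), (4,±6), (10,±6),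
(12,±6)`, all with `j = 5`, the one supersingular `j` at `13` (`13 ≡ 1 (mod 12)`: `[13/12] + 0 = 1`).
[cite: SilvermanAEC2009, Thm. V.4.1(a),(c)] [cite: Deuring1941, (the results of SilvermanAEC2009 Thm. V.4.1 incl. (c), the count of supersingular invariants, per Silverman Remark V.4.1.1)] -/
theorem traceZero13_iff : ∀ AB : ZMod 13 × ZMod 13,
    TraceZero 13 AB ↔ (AB ≠ (0, 0) ∧ 7 * AB.1 ^ 3 + 2 * AB.2 ^ 2 = 0) := by
  decide

set_option maxRecDepth 400000 in
set_option maxHeartbeats 8000000 in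
/-- `N_ss(13) = 12` trace-zero classes mod 13 (`= p - 1` pairs over `j = 5`). [cite: SilvermanAEC2009, Thm. V.4.1(a),(c)] -/
theorem card_traceZero13 : (Finset.univ.filter (TraceZero 13)).card = 12 := by decide

set_option maxRecDepth 400000 in
set_option maxHeartbeats 8000000 in
/-- Nonsingular classes mod 13: `13² - 13 = 156`. [folklore] -/
theorem card_disc13_ne_zero :
    (Finset.univ.filter (fun AB : ZMod 13 × ZMod 13 => disc AB.1 AB.2 ≠ 0)).card = 156 := by
  decide

set_option maxRecDepth 400000 in
set_option maxHeartbeats 8000000 in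
/-- The twelve trace-zero pairs mod 13 have `j = 5`: `1728 · 4A³ = 5 · (4A³ + 27B²)` on each of them. [cite: Deuring1941, (the results of SilvermanAEC2009 Thm. V.4.1 incl. (c), the count of supersingular invariants, per Silverman Remark V.4.1.1)] [folklore] -/
theorem traceZero13_j_eq_five : ∀ AB : ZMod 13 × ZMod 13,
    TraceZero 13 AB → (1728 * (4 * AB.1 ^ 3) : ZMod 13) = 5 * disc AB.1 AB.2 := by
  decide

/-! ## §3. The exact naive-height densities these classes give (S-free rows of the census) -/

/-- In-family density of ADDITIVE reduction at a prime `p ≥ 5` for the short family: the pairs `p ∣ A, p ∣ B` minus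
the non-minimal ones `p⁴ ∣ A, p⁶ ∣ B`, renormalised: `(p⁻² - p⁻¹⁰)/(1 - p⁻¹⁰)`.  (At `p = 2, 3` this formula is FALSE —
there Tate's algorithm gives `μ2_additive = 340/341`, `μ3_additive = 2460/7381` of the imported file.)
[cite: BhargavaSkinnerZhang2014, §3.1 and Lemma 17] [folklore] -/
def μ_add (p : ℕ) : ℚ := (1 / (p : ℚ) ^ 2 - 1 / (p : ℚ) ^ 10) / fam p

/-- In-family density of a union of `N` residue classes mod `p` contained in the good disc: `(N/p²)/(1 - p⁻¹⁰)`;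
with `N = N_ss(p)` this is the trace-zero (supersingular) density. [cite: BhargavaSkinnerZhang2014, §3.1 and Lemma 17] [folklore] -/
def μ_ssN (p N : ℕ) : ℚ := ((N : ℚ) / (p : ℚ) ^ 2) / fam p

/-- Agreement with the imported `5`-adic constants: `μ_add 5 = μ_add5 = 16276/406901`. [cite: BhargavaSkinnerZhang2014, §3.1 and Lemma 17] -/
theorem μ_add_five : μ_add 5 = μ_add5 := by norm_num [μ_add, μ_add5, fam]

/-- Agreement with the imported `5`-adic constants: `μ_ssN 5 4 = μ_ss5 = 390625/2441406`. [cite: BhargavaSkinnerZhang2014, §3.1 and Lemma 17] -/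
theorem μ_ssN_five : μ_ssN 5 4 = μ_ss5 := by norm_num [μ_ssN, μ_ss5, fam]

/-- Closed form `μ_add(p) = (p⁸ - 1)/(p¹⁰ - 1)` for every `p ≥ 2` (as arithmetic; as a DENSITY it is the additive
mass only for `p ≥ 5`). [folklore] -/
theorem μ_add_closed_form (p : ℕ) (hp : 2 ≤ p) :
    μ_add p = ((p : ℚ) ^ 8 - 1) / ((p : ℚ) ^ 10 - 1) := by
  have hp1 : (1 : ℚ) < p := by exact_mod_cast hp
  have hp0 : (p : ℚ) ≠ 0 := by positivity
  have h10 : (p : ℚ) ^ 10 - 1 ≠ 0 := by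
    have : (1 : ℚ) < (p : ℚ) ^ 10 := one_lt_pow₀ hp1 (by norm_num)
    linarith
  unfold μ_add fam
  field_simp

/-- The values used in the census: `μ_add 7 = 120100/5884901 (.0204082)`, `μ_add 11 = 1786324/216145205 (.0082645)`,
`μ_add 13 = 4855540/820586261 (.0059172)`. [folklore] -/
theorem μ_add_values : μ_add 7 = 120100 / 5884901 ∧ μ_add 11 = 1786324 / 216145205 ∧
    μ_add 13 = 4855540 / 820586261 := by
  refine ⟨?_, ?_, ?_⟩ <;> norm_num [μ_add, fam]

/-- Trace-zero densities: `μ_ssN 7 6 = 5764801/47079208 (.1224490)`, `μ_ssN 11 20 = 214358881/1296871230 (.1652893)`,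
`μ_ssN 13 12 = 815730721/11488207654 (.0710059)`. [folklore] -/
theorem μ_ssN_values : μ_ssN 7 6 = 5764801 / 47079208 ∧ μ_ssN 11 20 = 214358881 / 1296871230 ∧
    μ_ssN 13 12 = 815730721 / 11488207654 := by
  refine ⟨?_, ?_, ?_⟩ <;> norm_num [μ_ssN, fam]

/-- "Open by class theorem in analytic rank 0 at `p`" for a generic member of the family = additive ∪ trace-zero at `p`:
when `N_ss(p) = p - 1` (one supersingular `j ∉ {0, 1728}`, or `p = 5, 7`) the density is `(p⁹ - 1)/(p¹⁰ - 1)`.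
[folklore] -/
theorem μ_add_add_μ_ssN_of_pred (p : ℕ) (hp : 2 ≤ p) :
    μ_add p + μ_ssN p (p - 1) = ((p : ℚ) ^ 9 - 1) / ((p : ℚ) ^ 10 - 1) := by
  have hp1 : (1 : ℚ) < p := by exact_mod_cast hp
  have hp0 : (p : ℚ) ≠ 0 := by positivity
  have h10 : (p : ℚ) ^ 10 - 1 ≠ 0 := by
    have : (1 : ℚ) < (p : ℚ) ^ 10 := one_lt_pow₀ hp1 (by norm_num)
    linarith
  have hcast : ((p - 1 : ℕ) : ℚ) = (p : ℚ) - 1 := by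
    rw [Nat.cast_sub (by omega)]; norm_num
  unfold μ_add μ_ssN fam
  rw [hcast]
  field_simp
  ring

/-- … and that density is strictly below `1/p`. [folklore] -/
theorem pred_ratio_lt_inv (p : ℕ) (hp : 2 ≤ p) :
    ((p : ℚ) ^ 9 - 1) / ((p : ℚ) ^ 10 - 1) < 1 / p := by
  have hp1 : (1 : ℚ) < p := by exact_mod_cast hp
  have hp0 : (0 : ℚ) < p := by positivity
  have h10 : (0 : ℚ) < (p : ℚ) ^ 10 - 1 := by
    have : (1 : ℚ) < (p : ℚ) ^ 10 := one_lt_pow₀ hp1 (by norm_num)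
    linarith
  rw [div_lt_div_iff₀ h10 hp0]
  nlinarith

/-- Rank-0 open-by-class densities at the four census primes: `5: 488281/2441406 (= .2000000)`, `7: 6725601/47079208
(.1428571)`, `11: 45015365/259374246 (.1735537)`, `13: 883708281/11488207654 (.0769231)`. [folklore] -/
theorem open_rank0_values :
    μ_add 5 + μ_ssN 5 4 = 488281 / 2441406 ∧ μ_add 7 + μ_ssN 7 6 = 6725601 / 47079208 ∧
    μ_add 11 + μ_ssN 11 20 = 45015365 / 259374246 ∧ μ_add 13 + μ_ssN 13 12 = 883708281 / 11488207654 := by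
  refine ⟨?_, ?_, ?_, ?_⟩ <;> norm_num [μ_add, μ_ssN, fam]

/-- At `11` (two supersingular `j`, `N_ss = 20 = 2(p - 1)`): the closed form is `(21·11⁸ - 1)/(11¹⁰ - 1)`. [folklore] -/
theorem open_rank0_eleven_closed_form :
    μ_add 11 + μ_ssN 11 20 = (21 * 11 ^ 8 - 1 : ℚ) / (11 ^ 10 - 1) := by
  norm_num [μ_add, μ_ssN, fam]

/-- Union over `p ∈ {5, 7, 11, 13}` of "rank-0 open by class at `p`" (independent `p`-adic conditions, product measure):
`1 - ∏ (1 - (μ_add p + μ_ss p))` lies in `(0.4768866, 0.4768868)` — the census value `.4768867`. [folklore] -/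
theorem open_rank0_union_bounds :
    (0.4768866 : ℚ) < 1 - (1 - (μ_add 5 + μ_ssN 5 4)) * (1 - (μ_add 7 + μ_ssN 7 6)) *
        (1 - (μ_add 11 + μ_ssN 11 20)) * (1 - (μ_add 13 + μ_ssN 13 12)) ∧
    1 - (1 - (μ_add 5 + μ_ssN 5 4)) * (1 - (μ_add 7 + μ_ssN 7 6)) *
        (1 - (μ_add 11 + μ_ssN 11 20)) * (1 - (μ_add 13 + μ_ssN 13 12)) < (0.4768868 : ℚ) := by
  constructor <;> norm_num [μ_add, μ_ssN, fam]

/-- At `p = 3`, rank 0: everything but the ordinary and multiplicative slivers is open by class: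
`1 - (μ3_goodOrd + μ3_mult) = 1 - 1/29524 = 29523/29524`. [folklore] -/
theorem open_rank0_three : 1 - (μ3_goodOrd + μ3_mult) = 29523 / 29524 := by
  norm_num [μ3_goodOrd, μ3_mult]

/-- … and it is the disjoint sum additive + (ss, a₃ = 0) + (ss, a₃ = ±3): `2460/7381 + 6561/14762 + 6561/29524 = 29523/29524`. [folklore] -/
theorem open_rank0_three_split : μ3_additive + μ3_ss_a3zero + μ3_ss_a3pm = 29523 / 29524 := by
  norm_num [μ3_additive, μ3_ss_a3zero, μ3_ss_a3pm]

/-- The semistability split of a trace-zero row is a partition whatever the co-factor: with `c = S/μ_p(sst)` the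
rows "ss ∧ E semistable" (`μ·c`, census X6) and "ss ∧ E not semistable" (`μ·(1 - c)`, census X7) add up to `μ`.
(Pure algebra; the value of `c` is an interval-certified Euler product, not entered.) [folklore] -/
theorem semistable_split (μ c : ℚ) : μ * c + μ * (1 - c) = μ := by ring

/-! ## §4. The multiplicative (nodal) classes at `p ≥ 5`, the type partition, and the rank-1 'open by class' rows (S-free)

Added 2026-08-18.  A residue class `(A, B) mod p` other than `(0, 0)` has in-family density `p⁻²/(1 - p⁻¹⁰)` (the
excluded non-minimal pairs `p⁴ ∣ A, p⁶ ∣ B` all lie in the class `(0, 0)`); the nodal classes `4A³ + 27B² ≡ 0,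
A ≢ 0` are `p - 1` in number (`card_nodal_zmod`) and carry multiplicative reduction (the short model is minimal there),
so `μ_mult(p) = ((p - 1)/p²)/(1 - p⁻¹⁰)` for every prime `p ≥ 5` [BhargavaSkinnerZhang2014, §3.1; Lemma 18 is the
case `p = 5` refined by `v₅(Δ)`].  The rest is exact rational arithmetic. -/

/-- In-family density of MULTIPLICATIVE reduction at a prime `p ≥ 5` for the short family `y² = x³ + Ax + B`: the `p - 1`
nodal classes mod `p`, renormalised: `((p - 1)/p²)/(1 - p⁻¹⁰)`.  (As a DENSITY this is false at `p = 2, 3`, where Tate's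
algorithm gives `μ3_mult = 1/88572` etc. of the imported file; as arithmetic it is defined for every `p`.)
[cite: BhargavaSkinnerZhang2014, §3.1 and Lemmas 17–18] [folklore] -/
def μ_mult (p : ℕ) : ℚ := (((p : ℚ) - 1) / (p : ℚ) ^ 2) / fam p

/-- `μ_mult p` is the density of `p - 1` residue classes avoiding `(0,0)`: `μ_mult p = μ_ssN p (p - 1)`. [folklore] -/
theorem μ_mult_eq_μ_ssN (p : ℕ) (hp : 1 ≤ p) : μ_mult p = μ_ssN p (p - 1) := by
  unfold μ_mult μ_ssN
  rw [Nat.cast_sub hp, Nat.cast_one]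

/-- Tie to the class count: for every prime `p ≥ 5` the nodal classes `disc = 0, A ≠ 0` in `(ℤ/p)²` number `p - 1`
(`card_nodal_zmod` of `NodalClasses`), so their renormalised mass is `μ_mult p`. [folklore] -/
theorem μ_mult_eq_card_nodal (p : ℕ) [Fact p.Prime] (hp : 5 ≤ p) :
    (((Finset.univ.filter (fun AB : ZMod p × ZMod p => disc AB.1 AB.2 = 0 ∧ AB.1 ≠ 0)).card : ℚ) / (p : ℚ) ^ 2) /
      fam p = μ_mult p := by
  rw [card_nodal_zmod p hp, Nat.cast_sub (by omega : 1 ≤ p), Nat.cast_one, μ_mult]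

/-- At `5` the nodal classes are the four classes `Mult5` of the imported file (`card_mult5 = 4`; the same predicate). [cite: BhargavaSkinnerZhang2014, §3.1 and Lemmas 17–18] -/
theorem card_nodal_five_eq_card_mult5 :
    (Finset.univ.filter (fun AB : ZMod 5 × ZMod 5 => disc AB.1 AB.2 = 0 ∧ AB.1 ≠ 0)).card =
      (Finset.univ.filter Mult5).card := by
  rw [card_mult5]; decide

/-- `μ_mult 5 = 390625/2441406 (= .1600000164)`, and it equals `μ_ss5` (`N_ss(5) = 4 = p - 1`). [cite: BhargavaSkinnerZhang2014, §3.1 and Lemmas 17–18] -/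
theorem μ_mult_five : μ_mult 5 = 390625 / 2441406 ∧ μ_mult 5 = μ_ss5 := by
  constructor <;> norm_num [μ_mult, μ_ss5, fam]

/-- … and it is the sum of the five multiplicative cells of BSZ Lemma 18 (corrected) of the imported file: nonsplit with
`5 ∤ v₅(Δ)`, split `𝓛`-ok, split `𝓛`-bad, nonsplit with `5 ∣ v₅(Δ)`, split with `5 ∣ v₅(Δ)`
(`25390625 + 20312500 + 5078125)/317789681 + 2·390625/3813476172`). [cite: BhargavaSkinnerZhang2014, Lemma 18] -/
theorem μ_mult_five_cells : μ_mult 5 = μ_ns_ok5 + μ_sp_ok5 + μ_sp_badL5 + μ_ns_badv5 + μ_sp_badv5 := by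
  norm_num [μ_mult, fam, μ_ns_ok5, μ_sp_ok5, μ_sp_badL5, μ_ns_badv5, μ_sp_badv5]

/-- The four reduction types partition the family at `5`: `μ_go5 + μ_ss5 + μ_mult 5 + μ_add5 = 1`. [cite: BhargavaSkinnerZhang2014, Lemma 17] -/
theorem types_five_sum : μ_go5 + μ_ss5 + μ_mult 5 + μ_add5 = 1 := by
  norm_num [μ_go5, μ_ss5, μ_mult, μ_add5, fam]

/-- Closed form `μ_mult p = (p - 1)p⁸/(p¹⁰ - 1)` for every `p ≥ 2` (as arithmetic; as a density for `p ≥ 5`). [folklore] -/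
theorem μ_mult_closed_form (p : ℕ) (hp : 2 ≤ p) :
    μ_mult p = ((p : ℚ) - 1) * (p : ℚ) ^ 8 / ((p : ℚ) ^ 10 - 1) := by
  have hp1 : (1 : ℚ) < p := by exact_mod_cast hp
  have hp0 : (p : ℚ) ≠ 0 := by positivity
  have h10 : (p : ℚ) ^ 10 - 1 ≠ 0 := by
    have : (1 : ℚ) < (p : ℚ) ^ 10 := one_lt_pow₀ hp1 (by norm_num)
    linarith
  unfold μ_mult fam
  field_simp

/-- The census values: `μ_mult 7 = 5764801/47079208 (.1224490)`, `μ_mult 11 = 214358881/2593742460 (.0826446)`,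
`μ_mult 13 = 815730721/11488207654 (.0710059)`. [folklore] -/
theorem μ_mult_values : μ_mult 7 = 5764801 / 47079208 ∧ μ_mult 11 = 214358881 / 2593742460 ∧
    μ_mult 13 = 815730721 / 11488207654 := by
  refine ⟨?_, ?_, ?_⟩ <;> norm_num [μ_mult, fam]

/-- Multiplicative mass = trace-zero mass exactly when `N_ss(p) = p - 1`: at `5, 7, 13` (`N_ss = 4, 6, 12`); at `11`
(`N_ss = 20 = 2(p - 1)`) the trace-zero mass is twice the multiplicative one. [folklore] -/
theorem μ_mult_vs_μ_ssN_census : μ_mult 5 = μ_ssN 5 4 ∧ μ_mult 7 = μ_ssN 7 6 ∧ μ_mult 13 = μ_ssN 13 12 ∧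
    μ_ssN 11 20 = 2 * μ_mult 11 := by
  refine ⟨?_, ?_, ?_, ?_⟩ <;> norm_num [μ_mult, μ_ssN, fam]

/-- In-family density of GOOD ORDINARY reduction at a prime `p ≥ 5` given the trace-zero count `N = N_ss(p)`: the
`p² - p` classes with `disc ≢ 0` (all `p²` classes minus the `p - 1` nodal ones and `(0,0)`) minus the `N` trace-zero
ones, renormalised: `((p² - p - N)/p²)/(1 - p⁻¹⁰)`. [cite: BhargavaSkinnerZhang2014, §3.1 and Lemma 17] [folklore] -/
def μ_ordN (p N : ℕ) : ℚ := (((p : ℚ) ^ 2 - p - N) / (p : ℚ) ^ 2) / fam p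

/-- Agreement with the imported `5`-adic constant: `μ_ordN 5 4 = μ_go5 = 781250/1220703` (`16` ordinary classes). [cite: BhargavaSkinnerZhang2014, Lemma 17] -/
theorem μ_ordN_five : μ_ordN 5 4 = μ_go5 := by norm_num [μ_ordN, μ_go5, fam]

/-- The census values `μ_ordN 7 6 = 17294403/23539604 (.7346939)`, `μ_ordN 11 20 = 643076643/864580820 (.7438017)`,
`μ_ordN 13 12 = 4894384326/5744103827 (.8520710)`. [folklore] -/
theorem μ_ordN_values : μ_ordN 7 6 = 17294403 / 23539604 ∧ μ_ordN 11 20 = 643076643 / 864580820 ∧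
    μ_ordN 13 12 = 4894384326 / 5744103827 := by
  refine ⟨?_, ?_, ?_⟩ <;> norm_num [μ_ordN, fam]

/-- TYPE PARTITION: ordinary + trace-zero + multiplicative + additive = 1, for every `p ≥ 2` and every `N`
(`(p² - p - N) + N + (p - 1) + (1 - p⁻⁸) = p²(1 - p⁻¹⁰)`). [folklore] -/
theorem types_partition (p N : ℕ) (hp : 2 ≤ p) : μ_ordN p N + μ_ssN p N + μ_mult p + μ_add p = 1 := by
  have hp1 : (1 : ℚ) < p := by exact_mod_cast hp
  have hp0 : (p : ℚ) ≠ 0 := by positivity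
  have hfam : fam p ≠ 0 := by
    unfold fam
    have : (1 : ℚ) < (p : ℚ) ^ 10 := one_lt_pow₀ hp1 (by norm_num)
    have h' : 1 / (p : ℚ) ^ 10 < 1 := by
      rw [div_lt_one (by positivity)]; exact this
    linarith
  unfold μ_ordN μ_ssN μ_mult μ_add
  rw [← add_div, ← add_div, ← add_div, div_eq_one_iff_eq hfam]
  unfold fam
  field_simp
  ring

/-- RANK-1 'OPEN BY CLASS' at `p` when no class theorem covers the ordinary-complement: additive ∪ trace-zero ∪
multiplicative `= 1 - μ_ord`, for every `p ≥ 2` and every `N`. [folklore] -/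
theorem open_rank1_eq_one_sub_ord (p N : ℕ) (hp : 2 ≤ p) :
    μ_add p + μ_ssN p N + μ_mult p = 1 - μ_ordN p N := by
  have h := types_partition p N hp
  linarith

/-- When `N_ss(p) = p - 1` (e.g. `p = 5, 7, 13`) the rank-1 density has the closed form `(2p⁹ - p⁸ - 1)/(p¹⁰ - 1)`. [folklore] -/
theorem open_rank1_of_pred (p : ℕ) (hp : 2 ≤ p) :
    μ_add p + μ_ssN p (p - 1) + μ_mult p = (2 * (p : ℚ) ^ 9 - (p : ℚ) ^ 8 - 1) / ((p : ℚ) ^ 10 - 1) := by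
  have hp1 : (1 : ℚ) < p := by exact_mod_cast hp
  have hp0 : (p : ℚ) ≠ 0 := by positivity
  have h10 : (p : ℚ) ^ 10 - 1 ≠ 0 := by
    have : (1 : ℚ) < (p : ℚ) ^ 10 := one_lt_pow₀ hp1 (by norm_num)
    linarith
  rw [← μ_mult_eq_μ_ssN p (by omega)]
  unfold μ_add μ_mult fam
  field_simp
  ring

/-- Rank-1 'open by class' densities at the four census primes (exact, no Euler product): `5: 439453/1220703 (= .3599999)`,
`7: 6245201/23539604 (.2653061)`, `11: 221504177/864580820 (.2561983)`, `13: 849719501/5744103827 (.1479290)`. [folklore] -/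
theorem open_rank1_values :
    μ_add 5 + μ_ssN 5 4 + μ_mult 5 = 439453 / 1220703 ∧ μ_add 7 + μ_ssN 7 6 + μ_mult 7 = 6245201 / 23539604 ∧
    μ_add 11 + μ_ssN 11 20 + μ_mult 11 = 221504177 / 864580820 ∧
    μ_add 13 + μ_ssN 13 12 + μ_mult 13 = 849719501 / 5744103827 := by
  refine ⟨?_, ?_, ?_, ?_⟩ <;> norm_num [μ_add, μ_ssN, μ_mult, fam]

/-- At `5` this is `1 - μ_go5 = 1 - (16/25)/(1 - 5⁻¹⁰)` (the sixteen ordinary classes are all that a class theorem in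
analytic rank 1 still covers at `5`). [cite: BhargavaSkinnerZhang2014, Lemma 17] -/
theorem open_rank1_five_eq : μ_add 5 + μ_ssN 5 4 + μ_mult 5 = 1 - μ_go5 := by
  norm_num [μ_add, μ_ssN, μ_mult, μ_go5, fam]

/-- Rank 1 exceeds rank 0 at each prime by exactly the multiplicative mass (bookkeeping). [folklore] -/
theorem open_rank1_sub_rank0 (p N : ℕ) : (μ_add p + μ_ssN p N + μ_mult p) - (μ_add p + μ_ssN p N) = μ_mult p := by
  ring

/-- Union over `p ∈ {5, 7, 11, 13}` of "rank-1 open by class at `p`" = `1 - ∏ μ_ord(p)` lies in `(0.7019978, 0.7019979)`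
(exact value `179203089019611112417091659/255275829915206061938732284`; the census prints `.7019979`). [folklore] -/
theorem open_rank1_union_bounds :
    (0.7019978 : ℚ) < 1 - μ_ordN 5 4 * μ_ordN 7 6 * μ_ordN 11 20 * μ_ordN 13 12 ∧
    1 - μ_ordN 5 4 * μ_ordN 7 6 * μ_ordN 11 20 * μ_ordN 13 12 < (0.7019979 : ℚ) := by
  constructor <;> norm_num [μ_ordN, fam]

/-- … written with the per-prime open sets: `1 - ∏ (1 - (μ_add + μ_ss + μ_mult)) = 1 - ∏ μ_ord`. [folklore] -/
theorem open_rank1_union_eq :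
    1 - (1 - (μ_add 5 + μ_ssN 5 4 + μ_mult 5)) * (1 - (μ_add 7 + μ_ssN 7 6 + μ_mult 7)) *
        (1 - (μ_add 11 + μ_ssN 11 20 + μ_mult 11)) * (1 - (μ_add 13 + μ_ssN 13 12 + μ_mult 13)) =
      1 - μ_ordN 5 4 * μ_ordN 7 6 * μ_ordN 11 20 * μ_ordN 13 12 := by
  rw [open_rank1_eq_one_sub_ord 5 4 (by norm_num), open_rank1_eq_one_sub_ord 7 6 (by norm_num),
    open_rank1_eq_one_sub_ord 11 20 (by norm_num), open_rank1_eq_one_sub_ord 13 12 (by norm_num)]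
  ring

/-- At `p = 3` nothing changes in rank 1 (the withdrawn row needed `p > 3`): the multiplicative class there is the
imported exact constant `μ3_mult = 1/88572 = (2/3¹¹)/(1 - 3⁻¹⁰)` (census row X11c), NOT `μ_mult 3`. [folklore] -/
theorem μ_mult_three_ne_tate : μ_mult 3 ≠ μ3_mult ∧ μ3_mult = 1 / 88572 := by
  constructor <;> norm_num [μ_mult, μ3_mult, fam]


end Literature.NumberTheory.EllipticCurves.BhargavaSkinnerZhang2014.Densities
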